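import Literature.Computability.Cryptography.EncryptionSchemesProofs
import Literature.Computability.Complexity.SearchToDecision
import Literature.Computability.Cryptography.OneWayFunctionsPneNP
import HarnessLib

/-!
# Secure public-key encryption implies `P ≠ NP`

Sibling file of `EncryptionSchemes.lean`. The existence hypothesis
`Literature.Computability.Cryptography.SecurePKEExist` ("there is an efficient, perfectly correct
public-key encryption scheme with indistinguishable encryptions") is a *cryptographic assumption*,
not a theorem of the literature: Goldreich lists it among the **open problems** of
*Foundations of Cryptography II* (§5.5.6: "Secure public-key encryption schemes exist if there
exist collections of (non-uniformly hard) trapdoor permutations (cf. Theorem 5.3.15). It is not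
known whether the converse holds (although secure public-key encryption schemes easily imply
one-way functions)"), and one-way functions imply `NP ⊄ BPP ⊇ P` (*Foundations of Cryptography I*,
§1.1 and §2.1; §2.7.4, Exercise 2). This file proves the corresponding statement *inside the
tree's model*:

* `PKEScheme.not_hasIndistinguishableEncryptions_of_NP_subset_P` — if `NP ⊆ P`, no public-key
  scheme with polynomial-time key generation and decryption and perfect correctness has
  indistinguishable encryptions;
* `NP_not_subset_P_of_securePKEExist : SecurePKEExist → ¬ (NP ⊆ P)` and
  `P_ne_NP_of_securePKEExist : SecurePKEExist → P ≠ NP`;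
* `pneNP_shape_of_securePKEExist` — the same in the shape of the registered summit statement
  (`∃ L, L ∈ PNPWave0.NP Bool ∧ L ∉ PNPWave0.P Bool`, Cook's Clay formulation), through the
  tree's model bridge `pneNP_shape_of_NP_not_subset_P` (`OneWayFunctionsPneNP.lean`).

So a discharge `SecurePKEExist_holds` would settle `P ≠ NP`; the named fact is an open problem
(CONVENTIONS §4), exactly like `OWFExist` (`P_ne_NP_of_OWFExist_holds`,
`CryptoFoundationsOneWayFunctionsProofs.lean`).

## The argument (Goldreich 2001, §2.7.4 Exercise 2, adapted from one-way functions to key pairs)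

Fix a scheme `(G, E, D)` and assume `NP ⊆ P`.

1. **Key search is an `NP`-search problem.** The relation
   `keyRel = {⟨⟨⟨u, v⟩, pk⟩, y⟩ | 1^{|y|} = v ∧ (G(1^{|u|}; y))₁ = pk}` is in `P` (recompute `G`
   and compare, `setOf_apply_eq_apply_mem_P`), so by search-to-decision under `NP ⊆ P`
   (`exists_searchFn_of_NP_subset_P`, Arora–Barak Thm. 2.18) some `g ∈ FP` maps every instance
   `⟨⟨1ⁿ, 1ᴸ⟩, pk⟩` that has a witness to coins `y` of length `L` with `(G(1ⁿ; y))₁ = pk`.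
2. **Any matching secret key decrypts.** If `L = L_G(n)` is the number of coins `G` tosses on
   `1ⁿ`, then `G(1ⁿ; y)` is in the support of the key-pair law, so by *perfect correctness* its
   second component decrypts every ciphertext in the support of `E_pk(m)` to `m`.
3. **The distinguisher.** On `⟨1ⁿ, ⟨pk, c⟩⟩` the eavesdropper `keyInvDist` recovers such a `y`,
   decrypts `c` with `(G(1ⁿ; y))₂` and outputs the first plaintext bit; on the messages
   `m₀ n = 0ⁿ`, `m₁ n = 1ⁿ` its advantage is `1` — provided it knows `L_G(n)`.
4. **The coin budget as the source of `L_G(n)`.** In the tree's `RandAlg` model the coin budget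
   `coinLen : ℕ → ℕ` of an algorithm is an arbitrary polynomially bounded function of the input
   length and `L_G` need not be computable. Exactly as in the accepted discharge
   `SKEScheme.HasIndMultipleEncryptions.hasIndistinguishableEncryptions_holds`
   (`EncryptionSchemesProofs.lean`, the distinguisher `stripDist`), we work along a sparse set `T`
   of security parameters on which the input length determines `n` (ciphertext laws have finite
   support, so input lengths at parameter `n` lie in a window `[2n + 4, 2n + 4 + B n]`; the
   windows of `T = range (sparseSeq id B')` are disjoint), and let `keyInvDist` toss exactly
   `L_G(n)` coins on the window of `n ∈ T`; the run function reads only the *number* of its coins.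
   The advantage is then `1` at every `n ∈ T`, `T` is infinite, and a negligible function is
   eventually `< 1/2`: contradiction.

Only key generation and decryption need to be polynomial-time; the encryption algorithm enters
only through the finiteness of its output law.

## References

* O. Goldreich, *Foundations of Cryptography II: Basic Applications*, CUP 2004, §5.5.6 (Open
  Problems), Thm. 5.3.15, Def. 5.1.1, Def. 5.2.2.
* O. Goldreich, *Foundations of Cryptography I: Basic Tools*, CUP 2001, §1.1, §1.3.4, §2.1,
  §2.7.4 Exercise 2 (one-way functions imply `P ≠ NP`; guideline: an `NP`-set whose membership
  in `P` yields a polynomial-time inverter).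
* S. Arora, B. Barak, *Computational Complexity: A Modern Approach*, CUP 2009, Thm. 2.18
  (decision versus search), §9.2 ("any of these assumptions implies `P ≠ NP`").
-/

namespace Literature.Computability.Cryptography

open Filter Asymptotics _root_.Computability Complexity

/-! ### The first plaintext bit, read off the `optionBool` encoding by a transducer -/

/-- `headBitOpt o`: the first bit of the string inside `o` (`false` if there is none).
[folklore] -/
def headBitOpt : Option (List Bool) → Bool
  | some (b :: _) => b
  | _ => false

/-- `headBitOpt (some (replicate (n+1) b)) = b`. [folklore] -/
@[simp] theorem headBitOpt_some_replicate_succ (n : ℕ) (b : Bool) :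
    headBitOpt (some (List.replicate (n + 1) b)) = b := rfl

/-- States of the head-bit transducer: before the tag bit, after the tag bit `1`, finished.
[folklore] -/
inductive OptHeadState
  | start
  | body
  | done
  deriving DecidableEq, Fintype

namespace OptHeadState

/-- Transitions of the head-bit transducer: the tag bit `0` (`none`) emits `0`; after the tag
bit `1` the next symbol is emitted; everything else is skipped. [folklore] -/
def δ : OptHeadState → Bool → OptHeadState × List Bool
  | start, true => (body, [])
  | start, false => (done, [false])
  | body, b => (done, [b])
  | done, _ => (done, [])

/-- Final word: `0` unless a bit was emitted (`some []` and the empty input give `0`).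
[folklore] -/
def front : OptHeadState → List Bool
  | done => []
  | _ => [false]

end OptHeadState

/-- The head-bit transducer (a finite-state transducer in the sense of `Transducers.lean`).
[Hopcroft–Ullman 1979, §2.7 (Mealy machines)] [folklore] -/
def optHeadFST : FST OptHeadState Bool Bool where
  init := OptHeadState.start
  step := OptHeadState.δ
  front := OptHeadState.front
  keep _ := true

/-- `optHeadFn`: the transduction of `optHeadFST`. [folklore] -/
def optHeadFn : List Bool → List Bool :=
  optHeadFST.eval

/-- `optHeadFn ∈ FP` (finite-state transductions are polynomial time,
`FST.polyTimeComputable_eval`). [Arora–Barak 2009, §1.2] [cite: AroraBarak2009, §1.2] -/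
theorem optHeadFn_mem_FP : optHeadFn ∈ FP :=
  optHeadFST.polyTimeComputable_eval

/-- In state `done` nothing more is emitted. [folklore] -/
theorem optHeadFST_run_done (w : List Bool) :
    optHeadFST.run OptHeadState.done w = (OptHeadState.done, []) := by
  induction w with
  | nil => rfl
  | cons b w ih =>
    rw [FST.run_cons, show optHeadFST.step OptHeadState.done b = (OptHeadState.done, []) from rfl,
      ih]
    rfl

/-- **The transducer reads the first plaintext bit**: on the `optionBool` encoding of
`o : Option (List Bool)` (`none ↦ 0`, `some m ↦ 1 m`) it outputs `[headBitOpt o]`.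
[Arora–Barak 2009, §0.1] [cite: AroraBarak2009, §0.1] -/
theorem optHeadFn_encode (o : Option (List Bool)) :
    optHeadFn (((encodingList Bool).optionBool).encode o) = encodeBool (headBitOpt o) := by
  rcases o with _ | _ | ⟨b, m⟩
  · rfl
  · rfl
  · show optHeadFST.eval (true :: b :: m) = [b]
    simp only [FST.eval, FST.run_cons]
    rw [show optHeadFST.init = OptHeadState.start from rfl,
      show optHeadFST.step OptHeadState.start true = (OptHeadState.body, []) from rfl]
    rw [show optHeadFST.step OptHeadState.body b = (OptHeadState.done, [b]) from rfl,
      optHeadFST_run_done]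
    rfl


/-! ### Small helpers -/

/-- `|1ⁿ| = n` for Mathlib's `unaryEncodeNat`. [folklore] -/
private theorem length_unaryEncodeNat_pne (n : ℕ) : (unaryEncodeNat n).length = n := by
  induction n with
  | zero => rfl
  | succ n ih => simp [unaryEncodeNat, ih]

/-- Evaluation of an `ℕ`-polynomial is monotone in the argument. [folklore] -/
private theorem poly_eval_mono (q : Polynomial ℕ) {x y : ℕ} (hxy : x ≤ y) :
    q.eval x ≤ q.eval y := by
  induction q using Polynomial.induction_on' with
  | add p q hp hq => simp only [Polynomial.eval_add]; exact Nat.add_le_add hp hq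
  | monomial n c =>
    simp only [Polynomial.eval_monomial]
    exact Nat.mul_le_mul_left c (Nat.pow_le_pow_left hxy n)

/-- Reindexing the input of a polynomial-time function along any map (same machine; cf.
`PolyTimeComputable.precomp`, `NPBridge.lean`). [folklore] -/
private theorem ptc_precomp {α α' β Γ₀ Γ₁ : Type} {ea : α → List Γ₀} {eb : β → List Γ₁}
    {f : α → β} (h : PolyTimeComputable ea eb f) (k : α' → α) :
    PolyTimeComputable (ea ∘ k) eb (f ∘ k) := by
  obtain ⟨p, M, hM⟩ := h
  exact ⟨p, M, fun a => hM (k a)⟩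

/-- Changing the output presentation of a polynomial-time function without changing the output
words (same machine; cf. `PolyTimeComputable.of_output_eq`, `NPBridge.lean`). [folklore] -/
private theorem ptc_output_eq {α β β' Γ₀ Γ₁ : Type} {ea : α → List Γ₀} {eb : β → List Γ₁}
    {eb' : β' → List Γ₁} {f : α → β} {f' : α → β'} (h : PolyTimeComputable ea eb f)
    (he : ∀ a, eb' (f' a) = eb (f a)) : PolyTimeComputable ea eb' f' := by
  obtain ⟨p, M, hM⟩ := h
  refine ⟨p, M, fun a => ?_⟩
  rw [he a]
  exact hM a

/-- `boolUnpair` undoes `pairCode`. [Arora–Barak 2009, §0.1] [cite: AroraBarak2009, §0.1] -/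
@[simp] theorem boolUnpair_pairCode (p : List Bool × List Bool) : boolUnpair (pairCode p) = p := by
  obtain ⟨a, b⟩ := p
  exact boolUnpair_boolPair a b

/-! ### Word-level forms of key generation and decryption -/

namespace PKEScheme

variable (K : PKEScheme)

/-- `K.keyCoins n`: the number of coins the key generator tosses on `1ⁿ`.
[Goldreich 2004, Def. 5.1.1] [cite: Goldreich2004, Def. 5.1.1] -/
def keyCoins (n : ℕ) : ℕ :=
  K.keyGen.coinLen (unaryEncodeNat n).length

/-- Key generation as a total string function: `K.keyGenW w = ⟨pk, sk⟩` with
`(pk, sk) = G(1^{|u|}; y)` for `(u, y) = boolUnpair w` (security parameter read off as the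
*length* of the first component, coins = second component).
[Goldreich 2004, Def. 5.1.1] [cite: Goldreich2004, Def. 5.1.1] -/
def keyGenW (w : List Bool) : List Bool :=
  pairCode (K.keyGen.run (boolUnpair w).1.length (boolUnpair w).2)

/-- `K.keyGenW ⟨u, y⟩ = ⟨G(1^{|u|}; y)⟩`. [folklore] -/
@[simp] theorem keyGenW_boolPair (u y : List Bool) :
    K.keyGenW (boolPair u y) = pairCode (K.keyGen.run u.length y) := by
  simp [keyGenW]

/-- `K.keyGenW ∈ FP` when key generation is probabilistic polynomial-time: normalise the argument
to `⟨1^{|u|}, y⟩` (`fanoutFn (onesFn ∘ fst) snd`), then run `G`'s machine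
(`PolyTimeComputable.comp_holds`). [Arora–Barak 2009, §1.3, Thm. 2.8 (proof)] [cite: AroraBarak2009, §1.3] -/
theorem keyGenW_mem_FP (hG : K.keyGen.IsPolyTime unaryEncodeNat pairCode) : K.keyGenW ∈ FP := by
  have h1 : fanoutFn (onesFn ∘ fun z => (boolUnpair z).1) (fun z => (boolUnpair z).2) ∈ FP :=
    fanoutFn_mem_FP (comp_mem_FP onesFn_mem_FP boolUnpairFst_mem_FP) boolUnpairSnd_mem_FP
  have h2 : PolyTimeComputable (id : List Bool → List Bool)
      (fun p : ℕ × List Bool => boolPair (unaryEncodeNat p.1) p.2)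
      (fun w => ((boolUnpair w).1.length, (boolUnpair w).2)) :=
    ptc_output_eq h1 fun w => by simp [onesFn]
  have h3 := PolyTimeComputable.comp_holds hG.1 h2
  show PolyTimeComputable id id K.keyGenW
  exact ptc_output_eq h3 fun w => rfl

/-- Decryption as a total string function: `K.decW ⟨sk, c⟩` is the `optionBool` encoding of
`D(sk, c)`. [Goldreich 2004, Def. 5.1.1] [cite: Goldreich2004, Def. 5.1.1] -/
def decW (w : List Bool) : List Bool :=
  ((encodingList Bool).optionBool).encode (K.dec (boolUnpair w).1 (boolUnpair w).2)

/-- `K.decW ⟨sk, c⟩ = enc (D(sk, c))`. [folklore] -/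
@[simp] theorem decW_boolPair (sk c : List Bool) :
    K.decW (boolPair sk c) = ((encodingList Bool).optionBool).encode (K.dec sk c) := by
  simp [decW]

/-- `K.decW ∈ FP` when decryption is polynomial-time (normalise the pair with `rePair`, then run
the decryption machine). [Arora–Barak 2009, §1.3, Thm. 2.8 (proof)] [cite: AroraBarak2009, §1.3] -/
theorem decW_mem_FP
    (hD : PolyTimeComputable pairCode ((encodingList Bool).optionBool).encode
      (Function.uncurry K.dec)) :
    K.decW ∈ FP := by
  have h1 : PolyTimeComputable (id : List Bool → List Bool) pairCode
      (fun w => ((boolUnpair w).1, (boolUnpair w).2)) :=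
    ptc_output_eq rePair_mem_FP fun w => rfl
  show PolyTimeComputable id id K.decW
  exact ptc_output_eq (PolyTimeComputable.comp_holds hD h1) fun w => rfl

/-! ### The key-search relation -/

/-- Left side of the key-search test: `w ↦ ⟨1^{|y|}, (G(1^{|u|}; y))₁⟩` where `y = (boolUnpair w).2`
and `u` is the first component of the first component of `(boolUnpair w).1`.
[Goldreich 2001, §2.7.4, Exercise 2 (guideline: recompute and compare)] [cite: Goldreich2001, §2.7.4 Exercise 2] -/
noncomputable def keyRelLhs : List Bool → List Bool :=
  fanoutFn (onesFn ∘ fun z => (boolUnpair z).2)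
    ((fun z => (boolUnpair z).1) ∘ K.keyGenW ∘
      fanoutFn
        ((fun z => (boolUnpair z).1) ∘ (fun z => (boolUnpair z).1) ∘ fun z => (boolUnpair z).1)
        (fun z => (boolUnpair z).2))

/-- Right side of the key-search test: `w ↦ ⟨v, pk⟩` where `⟨⟨u, v⟩, pk⟩ = (boolUnpair w).1`.
[Goldreich 2001, §2.7.4, Exercise 2] [cite: Goldreich2001, §2.7.4 Exercise 2] -/
noncomputable def keyRelRhs : List Bool → List Bool :=
  fanoutFn ((fun z => (boolUnpair z).2) ∘ (fun z => (boolUnpair z).1) ∘ fun z => (boolUnpair z).1)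
    ((fun z => (boolUnpair z).2) ∘ fun z => (boolUnpair z).1)

/-- **The key-search relation**
`keyRel = {⟨⟨⟨u, v⟩, pk⟩, y⟩ | 1^{|y|} = v ∧ (G(1^{|u|}; y))₁ = pk}`:
witnesses are coin strings of the prescribed length producing the public key `pk` (the analogue,
for key pairs, of Goldreich's `NP`-set `L_f` of an efficiently computable `f`).
[Goldreich 2001, §2.7.4, Exercise 2; Goldreich 2004, §5.5.6] [cite: Goldreich2001, §2.7.4 Exercise 2] -/
def keyRel : Language Bool :=
  {w | K.keyRelLhs w = keyRelRhs w}

/-- `K.keyRelLhs ∈ FP` (for PPT key generation).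
[Arora–Barak 2009, Thm. 2.8 (proof)] [cite: AroraBarak2009, §1.3] -/
theorem keyRelLhs_mem_FP (hG : K.keyGen.IsPolyTime unaryEncodeNat pairCode) :
    K.keyRelLhs ∈ FP :=
  fanoutFn_mem_FP (comp_mem_FP onesFn_mem_FP boolUnpairSnd_mem_FP)
    (comp_mem_FP boolUnpairFst_mem_FP (comp_mem_FP (K.keyGenW_mem_FP hG)
      (fanoutFn_mem_FP (comp_mem_FP boolUnpairFst_mem_FP
        (comp_mem_FP boolUnpairFst_mem_FP boolUnpairFst_mem_FP)) boolUnpairSnd_mem_FP)))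

/-- `keyRelRhs ∈ FP`. [Arora–Barak 2009, Thm. 2.8 (proof)] [cite: AroraBarak2009, §1.3] -/
theorem keyRelRhs_mem_FP : keyRelRhs ∈ FP :=
  fanoutFn_mem_FP
    (comp_mem_FP boolUnpairSnd_mem_FP (comp_mem_FP boolUnpairFst_mem_FP boolUnpairFst_mem_FP))
    (comp_mem_FP boolUnpairSnd_mem_FP boolUnpairFst_mem_FP)

/-- **`keyRel ∈ P`** (recompute `G` and compare: `setOf_apply_eq_apply_mem_P`).
[Goldreich 2001, §2.7.4, Exercise 2 (guideline)] [cite: Goldreich2001, §2.7.4 Exercise 2] -/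
theorem keyRel_mem_P (hG : K.keyGen.IsPolyTime unaryEncodeNat pairCode) :
    K.keyRel ∈ Classes.P :=
  setOf_apply_eq_apply_mem_P (K.keyRelLhs_mem_FP hG) keyRelRhs_mem_FP

/-- Membership of a coded instance/witness pair in `keyRel`. [folklore] -/
theorem boolPair_mem_keyRel_iff (u v pk y : List Bool) :
    boolPair (boolPair (boolPair u v) pk) y ∈ K.keyRel ↔
      unaryEncodeNat y.length = v ∧ (K.keyGen.run u.length y).1 = pk := by
  show K.keyRelLhs _ = keyRelRhs _ ↔ _
  simp only [keyRelLhs, keyRelRhs, fanoutFn_apply, Function.comp_apply, boolUnpair_boolPair,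
    keyGenW_boolPair, boolUnpair_pairCode, onesFn]
  constructor
  · intro h
    exact Prod.mk.inj (boolPair_injective (a₁ := (_, _)) (a₂ := (v, pk)) h)
  · rintro ⟨h1, h2⟩
    rw [h1, h2]

/-! ### The key-inverting eavesdropper -/

section KeyInvDist

variable (g : List Bool → List Bool) (T : Set ℕ) (B : ℕ → ℕ)

/-- The run function of the key-inverting eavesdropper on input `x = ⟨u, ⟨pk, c⟩⟩` with coin
string `rr` (only `|rr|` is used): form the instance `z = ⟨⟨u, 1^{|rr|}⟩, pk⟩`, let `y = g z`,
`(pk', sk') = G(1^{|u|}; y)`, and output the first bit of `D(sk', c)`.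
[Goldreich 2001, §2.7.4, Exercise 2; Goldreich 2004, §5.5.6] [cite: Goldreich2001, §2.7.4 Exercise 2] -/
def keyInvRun (x rr : List Bool) : Bool :=
  headBitOpt (K.dec
    (K.keyGen.run (boolUnpair x).1.length
      (g (boolPair (boolPair (boolUnpair x).1 (unaryEncodeNat rr.length))
        (boolUnpair (boolUnpair x).2).1))).2
    (boolUnpair (boolUnpair x).2).2)

open scoped Classical in
/-- `K.keyInvDist g T B`: the key-inverting eavesdropper with run function `keyInvRun` whose coin
budget on the input-length window `[2n + 4, 2n + 4 + B n]` of a parameter `n ∈ T` is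
`keyCoins n` (the key generator's coin count on `1ⁿ`), and `0` elsewhere; when `T` is sparse
relative to `B` the window determines `n` (`keyInvDist_coinLen`). The coin *values* are ignored:
the budget only transmits `keyCoins n` (cf. `stripDist`, `EncryptionSchemesProofs.lean`).
[Goldreich 2001, §2.7.4, Exercise 2; Goldreich 2004, §5.5.6] [cite: Goldreich2001, §2.7.4 Exercise 2] -/
noncomputable def keyInvDist : RandAlg (List Bool) Bool where
  run := K.keyInvRun g
  coinLen ℓ :=
    if h : ∃ n : ℕ, n ∈ T ∧ 2 * n + 4 ≤ ℓ ∧ ℓ ≤ 2 * n + 4 + B n then K.keyCoins h.choose else 0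

/-- The instance builder `⟨x, rr⟩ ↦ ⟨⟨u, 1^{|rr|}⟩, pk⟩` (`x = ⟨u, ⟨pk, c⟩⟩`) as an `FP` brick
expression. [Arora–Barak 2009, Thm. 2.8 (proof)] [cite: AroraBarak2009, §1.3] -/
noncomputable def keyInvInstW : List Bool → List Bool :=
  fanoutFn
    (fanoutFn ((fun z => (boolUnpair z).1) ∘ fun z => (boolUnpair z).1)
      (onesFn ∘ fun z => (boolUnpair z).2))
    ((fun z => (boolUnpair z).1) ∘ (fun z => (boolUnpair z).2) ∘ fun z => (boolUnpair z).1)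

/-- The recovered secret key `⟨x, rr⟩ ↦ (G(1^{|u|}; g z))₂`.
[Arora–Barak 2009, Thm. 2.8 (proof)] [cite: AroraBarak2009, §1.3] -/
noncomputable def keyInvSkW : List Bool → List Bool :=
  (fun z => (boolUnpair z).2) ∘ K.keyGenW ∘
    fanoutFn ((fun z => (boolUnpair z).1) ∘ fun z => (boolUnpair z).1) (g ∘ keyInvInstW)

/-- The output word `⟨x, rr⟩ ↦ optHeadFn (decW ⟨sk', c⟩)`.
[Arora–Barak 2009, Thm. 2.8 (proof)] [cite: AroraBarak2009, §1.3] -/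
noncomputable def keyInvOutW : List Bool → List Bool :=
  optHeadFn ∘ K.decW ∘
    fanoutFn (K.keyInvSkW g)
      ((fun z => (boolUnpair z).2) ∘ (fun z => (boolUnpair z).2) ∘ fun z => (boolUnpair z).1)

/-- `keyInvOutW ∈ FP` for PPT key generation, polynomial-time decryption and `g ∈ FP`.
[Arora–Barak 2009, Thm. 2.8 (proof: composition)] [cite: AroraBarak2009, §1.3] -/
theorem keyInvOutW_mem_FP (hG : K.keyGen.IsPolyTime unaryEncodeNat pairCode)
    (hD : PolyTimeComputable pairCode ((encodingList Bool).optionBool).encode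
      (Function.uncurry K.dec))
    (hg : g ∈ FP) : K.keyInvOutW g ∈ FP := by
  have hinst : keyInvInstW ∈ FP :=
    fanoutFn_mem_FP
      (fanoutFn_mem_FP (comp_mem_FP boolUnpairFst_mem_FP boolUnpairFst_mem_FP)
        (comp_mem_FP onesFn_mem_FP boolUnpairSnd_mem_FP))
      (comp_mem_FP boolUnpairFst_mem_FP (comp_mem_FP boolUnpairSnd_mem_FP boolUnpairFst_mem_FP))
  have hsk : K.keyInvSkW g ∈ FP :=
    comp_mem_FP boolUnpairSnd_mem_FP (comp_mem_FP (K.keyGenW_mem_FP hG)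
      (fanoutFn_mem_FP (comp_mem_FP boolUnpairFst_mem_FP boolUnpairFst_mem_FP)
        (comp_mem_FP hg hinst)))
  exact comp_mem_FP optHeadFn_mem_FP (comp_mem_FP (K.decW_mem_FP hD)
    (fanoutFn_mem_FP hsk
      (comp_mem_FP boolUnpairSnd_mem_FP (comp_mem_FP boolUnpairSnd_mem_FP boolUnpairFst_mem_FP))))

/-- The output word on `⟨x, rr⟩` is the encoded answer of `keyInvRun`. [folklore] -/
theorem keyInvOutW_boolPair (x rr : List Bool) :
    K.keyInvOutW g (boolPair x rr) = encodeBool (K.keyInvRun g x rr) := by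
  simp only [keyInvOutW, keyInvSkW, keyInvInstW, keyInvRun, Function.comp_apply, fanoutFn_apply,
    boolUnpair_boolPair, keyGenW_boolPair, boolUnpair_pairCode, decW_boolPair, optHeadFn_encode,
    onesFn]

/-- On a sparse parameter set (`n + B n < n'` for `n < n'` in `T`) the coin budget on the window
of `n ∈ T` is `keyCoins n`. [folklore] -/
theorem keyInvDist_coinLen (hsep : ∀ n ∈ T, ∀ n' ∈ T, n < n' → n + B n < n') {n ℓ : ℕ}
    (hn : n ∈ T) (hlo : 2 * n + 4 ≤ ℓ) (hhi : ℓ ≤ 2 * n + 4 + B n) :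
    (K.keyInvDist g T B).coinLen ℓ = K.keyCoins n := by
  have hex : ∃ n : ℕ, n ∈ T ∧ 2 * n + 4 ≤ ℓ ∧ ℓ ≤ 2 * n + 4 + B n := ⟨n, hn, hlo, hhi⟩
  simp only [keyInvDist]
  rw [dif_pos hex]
  obtain ⟨h1, h2, h3⟩ := hex.choose_spec
  congr 1
  rcases lt_trichotomy n hex.choose with hlt | heq | hgt
  · have := hsep n hn _ h1 hlt
    omega
  · exact heq.symm
  · have := hsep _ h1 n hn hgt
    omega

/-- **The key-inverting eavesdropper is PPT**: its run function is `keyInvOutW` read through the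
pairing of input and coins (reindex the input, re-present the output), and its coin budget is
bounded by the key generator's polynomial (`keyCoins n ≤ p(n) ≤ p(ℓ)` on the window of `n`,
monotonicity of `ℕ`-polynomials). [Arora–Barak 2009, §1.3, Thm. 2.8 (proof); Goldreich 2001,
§1.3.2] [cite: AroraBarak2009, §1.3] -/
theorem keyInvDist_isPPT (hG : K.keyGen.IsPolyTime unaryEncodeNat pairCode)
    (hD : PolyTimeComputable pairCode ((encodingList Bool).optionBool).encode
      (Function.uncurry K.dec))
    (hg : g ∈ FP) : IsPPT (K.keyInvDist g T B) encodeBool := by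
  refine ⟨?_, ?_⟩
  · have h1 : PolyTimeComputable (id : List Bool → List Bool) (id : List Bool → List Bool)
        (K.keyInvOutW g) := K.keyInvOutW_mem_FP g hG hD hg
    have h2 := ptc_precomp h1 (fun p : List Bool × List Bool => boolPair p.1 p.2)
    exact ptc_output_eq h2 fun p => (K.keyInvOutW_boolPair g p.1 p.2).symm
  · obtain ⟨p, hp⟩ := hG.2
    refine ⟨p, fun ℓ => ?_⟩
    simp only [keyInvDist]
    split_ifs with h
    · obtain ⟨_, hlo, _⟩ := h.choose_spec
      unfold keyCoins
      refine (hp _).trans (poly_eval_mono p ?_)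
      rw [length_unaryEncodeNat_pne]
      omega
    · exact Nat.zero_le _

/-- **The eavesdropper recovers the first plaintext bit.** If `g` solves the key-search
problem on solvable instances, `r` is a coin string of the key generator's length at parameter
`n`, `c` is in the support of `E_pk(m)` for `pk = (G(1ⁿ; r))₁`, and `rr` has the same length as
`r`, then `keyInvRun` on `⟨1ⁿ, ⟨pk, c⟩⟩` with coins `rr` outputs `headBitOpt (some m)`: the
instance `⟨⟨1ⁿ, 1^{|rr|}⟩, pk⟩` has the witness `r`, so `y = g z` has length `|r|` and
`(G(1ⁿ; y))₁ = pk`; the pair `G(1ⁿ; y)` is in the support of the key law, hence by perfect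
correctness its secret key decrypts `c` to `m`. [Goldreich 2004, Def. 5.1.1 (2) (correctness for
every key pair in the range of `G`); Goldreich 2001, §2.7.4, Exercise 2] [cite: Goldreich2004, Def. 5.1.1] -/
theorem keyInvRun_eq (hcorr : K.IsCorrect)
    (hg : ∀ z : List Bool,
      (∃ y : List Bool, y.length ≤ (Polynomial.X : Polynomial ℕ).eval z.length ∧
          boolPair z y ∈ K.keyRel) →
        (g z).length ≤ (Polynomial.X : Polynomial ℕ).eval z.length ∧ boolPair z (g z) ∈ K.keyRel)
    {n : ℕ} {r : List Bool} (hr : r.length = K.keyCoins n) (m : List Bool) {c : List Bool}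
    (hc : c ∈ (K.ctPMF (K.keyGen.run n r).1 m).support) {rr : List Bool}
    (hrr : rr.length = K.keyCoins n) :
    K.keyInvRun g (boolPair (unaryEncodeNat n) (boolPair (K.keyGen.run n r).1 c)) rr =
      headBitOpt (some m) := by
  simp only [keyInvRun, boolUnpair_boolPair, length_unaryEncodeNat_pne]
  set pk := (K.keyGen.run n r).1 with hpk_def
  set z := boolPair (boolPair (unaryEncodeNat n) (unaryEncodeNat rr.length)) pk with hz
  have hsol : ∃ y : List Bool, y.length ≤ (Polynomial.X : Polynomial ℕ).eval z.length ∧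
      boolPair z y ∈ K.keyRel := by
    refine ⟨r, ?_, ?_⟩
    · rw [Polynomial.eval_X, hz, length_boolPair, length_boolPair, length_unaryEncodeNat_pne,
        length_unaryEncodeNat_pne]
      omega
    · rw [hz, boolPair_mem_keyRel_iff, length_unaryEncodeNat_pne, hr, hrr]
      exact ⟨rfl, rfl⟩
  obtain ⟨-, hmem⟩ := hg z hsol
  rw [hz, boolPair_mem_keyRel_iff, length_unaryEncodeNat_pne] at hmem
  obtain ⟨hlen, hpk⟩ := hmem
  have hlen' : (g z).length = K.keyCoins n := by
    have := congrArg List.length hlen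
    rw [length_unaryEncodeNat_pne, length_unaryEncodeNat_pne] at this
    rw [hz]
    omega
  have hsupp : K.keyGen.run n (g z) ∈ (K.keyPMF n).support := by
    unfold keyPMF RandAlg.outputPMF
    rw [PMF.support_map]
    refine ⟨⟨g z, hlen'⟩, ?_, rfl⟩
    rw [PMF.support_uniformOfFintype]
    trivial
  have hdec := hcorr n _ hsupp m c (by rw [hpk]; exact hc)
  rw [hdec]

/-- On an input `⟨1ⁿ, ⟨pk, c⟩⟩` from the support of the eavesdropping experiment at a parameter
`n ∈ T` (sparse `T`, sample length `≤ B n`) the output law of the key-inverting eavesdropper is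
the point mass at `headBitOpt (some m)`: it tosses exactly `keyCoins n` coins
(`keyInvDist_coinLen`) and `keyInvRun_eq` applies to every coin string.
[Goldreich 2001, §2.7.4, Exercise 2; Arora–Barak 2009, §7.1] [cite: Goldreich2001, §2.7.4 Exercise 2] -/
theorem keyInvDist_outputPMF (hcorr : K.IsCorrect)
    (hg : ∀ z : List Bool,
      (∃ y : List Bool, y.length ≤ (Polynomial.X : Polynomial ℕ).eval z.length ∧
          boolPair z y ∈ K.keyRel) →
        (g z).length ≤ (Polynomial.X : Polynomial ℕ).eval z.length ∧ boolPair z (g z) ∈ K.keyRel)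
    (hsep : ∀ n ∈ T, ∀ n' ∈ T, n < n' → n + B n < n') {n : ℕ} (hn : n ∈ T)
    {r : List Bool} (hr : r.length = K.keyCoins n) (m : List Bool) {c : List Bool}
    (hc : c ∈ (K.ctPMF (K.keyGen.run n r).1 m).support)
    (hB : (boolPair (K.keyGen.run n r).1 c).length ≤ B n) :
    (K.keyInvDist g T B).outputPMF id
        (boolPair (unaryEncodeNat n) (boolPair (K.keyGen.run n r).1 c)) =
      PMF.pure (headBitOpt (some m)) := by
  unfold RandAlg.outputPMF
  have hcoins : (K.keyInvDist g T B).coinLen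
      (id (boolPair (unaryEncodeNat n) (boolPair (K.keyGen.run n r).1 c))).length =
        K.keyCoins n := by
    have hlen := hB
    rw [length_boolPair] at hlen
    refine K.keyInvDist_coinLen g T B hsep hn ?_ ?_
    · simp only [id, length_boolPair, length_unaryEncodeNat_pne]
      omega
    · simp only [id, length_boolPair, length_unaryEncodeNat_pne]
      omega
  have hfun : (fun v : List.Vector Bool ((K.keyInvDist g T B).coinLen
        (id (boolPair (unaryEncodeNat n) (boolPair (K.keyGen.run n r).1 c))).length) =>
      (K.keyInvDist g T B).run (boolPair (unaryEncodeNat n) (boolPair (K.keyGen.run n r).1 c))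
        v.toList) = fun _ => headBitOpt (some m) := by
    funext v
    exact K.keyInvRun_eq g hcorr hg hr m hc (v.toList_length.trans hcoins)
  rw [hfun]
  exact PMF.map_const _ _

/-- Consequently, at a parameter `n ∈ T` whose samples obey the length bound `B n`, the
acceptance law of the key-inverting eavesdropper in the eavesdropping experiment for the
plaintext `m` is the point mass at the first bit of `m`. [Goldreich 2004, Def. 5.2.2;
Goldreich 2001, Def. 3.2.2] [cite: Goldreich2004, Def. 5.2.2] -/
theorem keyInvDist_acceptPMF (hcorr : K.IsCorrect)
    (hg : ∀ z : List Bool,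
      (∃ y : List Bool, y.length ≤ (Polynomial.X : Polynomial ℕ).eval z.length ∧
          boolPair z y ∈ K.keyRel) →
        (g z).length ≤ (Polynomial.X : Polynomial ℕ).eval z.length ∧ boolPair z (g z) ∈ K.keyRel)
    (hsep : ∀ n ∈ T, ∀ n' ∈ T, n < n' → n + B n < n') {n : ℕ} (hn : n ∈ T) (m : List Bool)
    (hB : ∀ s ∈ (K.pkEncPMF n m).support, s.length ≤ B n) :
    acceptPMF (K.keyInvDist g T B) n (K.pkEncPMF n m) = PMF.pure (headBitOpt (some m)) := by
  have hout : ∀ s ∈ (K.pkEncPMF n m).support,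
      (K.keyInvDist g T B).outputPMF id (boolPair (unaryEncodeNat n) s) =
        PMF.pure (headBitOpt (some m)) := by
    intro s hs
    have hsB := hB s hs
    unfold pkEncPMF at hs
    rw [PMF.mem_support_bind_iff] at hs
    obtain ⟨ks, hks, hs⟩ := hs
    rw [PMF.mem_support_map_iff] at hs
    obtain ⟨c, hc, rfl⟩ := hs
    unfold keyPMF RandAlg.outputPMF at hks
    rw [PMF.mem_support_map_iff] at hks
    obtain ⟨v, -, rfl⟩ := hks
    exact K.keyInvDist_outputPMF g T B hcorr hg hsep hn v.toList_length m hc hsB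
  unfold acceptPMF
  refine PMF.ext fun b => ?_
  rw [PMF.bind_apply]
  have hterm : ∀ s, (K.pkEncPMF n m) s *
      ((K.keyInvDist g T B).outputPMF id (boolPair (unaryEncodeNat n) s)) b =
        (K.pkEncPMF n m) s * (PMF.pure (headBitOpt (some m))) b := by
    intro s
    by_cases hs : s ∈ (K.pkEncPMF n m).support
    · rw [hout s hs]
    · rw [(PMF.apply_eq_zero_iff _ s).2 hs, zero_mul, zero_mul]
  rw [tsum_congr hterm, ENNReal.tsum_mul_right, PMF.tsum_coe, one_mul]

end KeyInvDist

/-- Samples `⟨pk, c⟩` of the public-key eavesdropping experiment at a fixed parameter and plaintext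
have bounded length (the law `pkEncPMF n m` has finite support: finitely many coin strings for `G`
and for `E`). [Goldreich 2004, Def. 5.1.1, Def. 5.2.2] [cite: Goldreich2004, Def. 5.2.2] -/
theorem exists_length_le_of_mem_support_pkEncPMF (n : ℕ) (m : List Bool) :
    ∃ Bn : ℕ, ∀ s ∈ (K.pkEncPMF n m).support, s.length ≤ Bn := by
  have hfin : (K.pkEncPMF n m).support.Finite := by
    unfold pkEncPMF
    rw [PMF.support_bind]
    refine (randAlg_support_outputPMF_finite _ _ _).biUnion fun ks _ => ?_
    rw [PMF.support_map]
    exact (randAlg_support_outputPMF_finite _ _ _).image _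
  obtain ⟨Bn, hBn⟩ := (hfin.image List.length).bddAbove
  exact ⟨Bn, fun s hs => hBn ⟨s, hs, rfl⟩⟩

end PKEScheme

/-! ### Secure public-key encryption implies `P ≠ NP` -/

/-- The all-zero challenge plaintexts `0ⁿ`.
[Goldreich 2004, Def. 5.2.2] [cite: Goldreich2004, Def. 5.2.2] -/
def zerosMsg (n : ℕ) : List Bool :=
  List.replicate n false

/-- The all-one challenge plaintexts `1ⁿ`.
[Goldreich 2004, Def. 5.2.2] [cite: Goldreich2004, Def. 5.2.2] -/
def onesMsg (n : ℕ) : List Bool :=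
  List.replicate n true

/-- `0ⁿ` has polynomial length. [folklore] -/
theorem isPolyLength_zerosMsg : IsPolyLength zerosMsg :=
  ⟨Polynomial.X, fun n => by simp [zerosMsg]⟩

/-- `|0ⁿ| = |1ⁿ|`. [folklore] -/
theorem length_zerosMsg_eq (n : ℕ) : (zerosMsg n).length = (onesMsg n).length := by
  simp [zerosMsg, onesMsg]

/-- **If `NP ⊆ P`, no public-key encryption scheme with probabilistic polynomial-time key
generation, polynomial-time decryption and perfect correctness has indistinguishable
encryptions.** Along the sparse parameter set `T = range (sparseSeq (· + 1) B)` the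
key-inverting eavesdropper `keyInvDist` (PPT by `keyInvDist_isPPT`, using the key-search function
supplied by `exists_searchFn_of_NP_subset_P` for `keyRel ∈ P`) tells `E_pk(0ⁿ)` from `E_pk(1ⁿ)`
with advantage `1` (`keyInvDist_acceptPMF`), while indistinguishability would make the advantage
eventually `< 1/2`. [Goldreich 2004, §5.5.6 ("secure public-key encryption schemes easily imply
one-way functions"); Goldreich 2001, §2.7.4, Exercise 2 and §2.1 (one-way functions imply
`NP ⊄ P`); Arora–Barak 2009, Thm. 2.18] [cite: Goldreich2001, §2.7.4 Exercise 2] -/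
theorem PKEScheme.not_hasIndistinguishableEncryptions_of_NP_subset_P
    (hNP : Nondeterministic.NP ⊆ Classes.P) (K : PKEScheme)
    (hG : K.keyGen.IsPolyTime unaryEncodeNat pairCode)
    (hD : PolyTimeComputable pairCode ((encodingList Bool).optionBool).encode
      (Function.uncurry K.dec))
    (hcorr : K.IsCorrect) : ¬ K.HasIndistinguishableEncryptions := by
  intro hind
  -- (1) the key-search function from `NP ⊆ P`
  obtain ⟨g, hgFP, hg⟩ := exists_searchFn_of_NP_subset_P hNP (K.keyRel_mem_P hG) Polynomial.X
  -- (2) length bounds on the samples and the sparse parameter set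
  have hBex : ∀ n, ∃ Bn : ℕ, (∀ s ∈ (K.pkEncPMF n (zerosMsg n)).support, s.length ≤ Bn) ∧
      ∀ s ∈ (K.pkEncPMF n (onesMsg n)).support, s.length ≤ Bn := fun n => by
    obtain ⟨B₀, hB₀⟩ := K.exists_length_le_of_mem_support_pkEncPMF n (zerosMsg n)
    obtain ⟨B₁, hB₁⟩ := K.exists_length_le_of_mem_support_pkEncPMF n (onesMsg n)
    exact ⟨max B₀ B₁, fun s hs => (hB₀ s hs).trans (le_max_left _ _),
      fun s hs => (hB₁ s hs).trans (le_max_right _ _)⟩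
  choose B hB₀ hB₁ using hBex
  have hge : ∀ a : ℕ, a ≤ (fun a => a + 1) a := fun a => Nat.le_succ a
  set φ := sparseSeq (fun a => a + 1) B with hφ
  have hmono : StrictMono φ := sparseSeq_strictMono hge
  have hsep := sparseSeq_range_sep (L := B) hge
  have hpos : ∀ i, 1 ≤ φ i :=
    sparseSeq_forall (L := B) (P := fun b => 1 ≤ b) fun a => Nat.succ_le_succ (Nat.zero_le a)
  -- (3) the key-inverting eavesdropper and its advantage `1` along `T = range φ`
  set D := K.keyInvDist g (Set.range φ) B with hDdef
  have hPPT : IsPPT D encodeBool := K.keyInvDist_isPPT g _ B hG hD hgFP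
  have hadv : ∀ i, pkEavAdvantage K D zerosMsg onesMsg (φ i) = 1 := by
    intro i
    have hT : φ i ∈ Set.range φ := ⟨i, rfl⟩
    unfold pkEavAdvantage distAdvantage PKEScheme.pkEncEnsemble
    rw [hDdef, K.keyInvDist_acceptPMF g _ B hcorr hg hsep hT (zerosMsg (φ i)) (hB₀ (φ i)),
      K.keyInvDist_acceptPMF g _ B hcorr hg hsep hT (onesMsg (φ i)) (hB₁ (φ i))]
    obtain ⟨k, hk⟩ : ∃ k, φ i = k + 1 := Nat.exists_eq_succ_of_ne_zero (by have := hpos i; omega)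
    rw [hk]
    simp only [zerosMsg, onesMsg, headBitOpt_some_replicate_succ, PMF.pure_apply]
    norm_num
  -- (4) indistinguishability: the advantage is eventually `< 1/2`
  have h0 := hind zerosMsg onesMsg isPolyLength_zerosMsg length_zerosMsg_eq D hPPT 0
  simp only [pow_zero, one_mul] at h0
  have hev := Metric.tendsto_nhds.1 h0 (1 / 2) (by norm_num)
  rw [Filter.eventually_atTop] at hev
  obtain ⟨N, hN⟩ := hev
  have hlt := hN (φ N) (hmono.id_le N)
  rw [hadv N] at hlt
  norm_num at hlt

/-- **Secure public-key encryption implies `NP ⊄ P`.** [Goldreich 2004, §5.5.6; Goldreich 2001,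
§2.1, §2.7.4 Exercise 2] [cite: Goldreich2004, §5.5.6] -/
theorem NP_not_subset_P_of_securePKEExist (h : SecurePKEExist) :
    ¬ (Nondeterministic.NP ⊆ Classes.P) :=
  fun hNP => h.elim fun K hK =>
    K.not_hasIndistinguishableEncryptions_of_NP_subset_P hNP hK.1.1 hK.1.2.2 hK.2.1 hK.2.2

/-- **Secure public-key encryption implies `P ≠ NP`** (since `P ⊆ NP` trivially gives the
inclusion the other way). So the existence hypothesis `SecurePKEExist` cannot be discharged without
settling `P ≠ NP`: it is an open problem (Goldreich 2004, §5.5.6), known to follow from the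
existence of non-uniformly hard trapdoor permutations (Goldreich 2004, Thm. 5.3.15).
[Goldreich 2004, §5.5.6; Goldreich 2001, §1.1, §2.1] [cite: Goldreich2004, §5.5.6] -/
theorem P_ne_NP_of_securePKEExist (h : SecurePKEExist) : Classes.P ≠ Nondeterministic.NP :=
  fun hPNP => NP_not_subset_P_of_securePKEExist h hPNP.symm.subset

/-- **`SecurePKEExist` implies Cook's `P ≠ NP` in the shape of the registered summit statement**
(`∃ L, L ∈ PNPWave0.NP Bool ∧ L ∉ PNPWave0.P Bool`), by `NP_not_subset_P_of_securePKEExist` and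
the tree's proved model bridge `pneNP_shape_of_NP_not_subset_P` (`OneWayFunctionsPneNP.lean`:
`PNPWave0.P Bool = Classes.P`, `PNPWave0.NP Bool = NP`). So the existence of secure public-key
encryption is at least as open as `P ≠ NP`. [Goldreich 2004, §5.5.6; Cook, Clay problem
description, §1] [cite: Goldreich2004, §5.5.6] -/
theorem pneNP_shape_of_securePKEExist (h : SecurePKEExist) :
    ∃ L : Language Bool, L ∈ Literature.Computability.Complexity.PNPWave0.NP Bool ∧
      L ∉ Literature.Computability.Complexity.PNPWave0.P Bool :=
  pneNP_shape_of_NP_not_subset_P (NP_not_subset_P_of_securePKEExist h)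

end Literature.Computability.Cryptography
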